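import Mathlib
import Literature.NumberTheory.LFunctions.HalaszEulerProduct
import Summits.RiemannHypothesis.RiemannHypothesis.Theorems.IntegerScrewExitFlow
import HarnessLib

/-!
# Route `IntegerScrew` — the exit-death chain's Green function INSIDE the `p`-free atom
# (CONTINUUM-LIMIT §25.10 (a)–(b), §25.11 (a)–(b): first half of THEOREM B/C's flow in the kernel)

The cells of THEOREM P₀ (`variance_le_of_atom_room_le`, staged `IntegerScrewMartingale`) are not all-integer:
after fixing the rough part and the `p`-valuation, a cell is the set of `p`-FREE numbers
`𝒜 = Nat.smoothNumbers p ∩ [1, R]` (every prime factor `< p`) with harmonic weights, window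
`W = 𝒜 ∩ (Q, R]` (`Q = R/p^k`, `k ≥ 1`), bottom `B = 𝒜 ∩ [1, Q]`, and the cell's Dirichlet form uses only the
deaths by prime powers of primes `< p` — for `x ∈ 𝒜` these are ALL prime-power divisors of `x`.
This file transplants the Green function of `IntegerScrewExitGreen` into the atom:

* `div_lt_of_lt` (`R/p < y ⇒ R/y < p`), `smooth_of_lt` (and the tree's `Halasz.one_mem_smoothNumbers`);
* `exitGammaAtom R Q p` — the atom's Green function `Γ_𝒜`: the recursion of `exitGamma` with the parents
  `x·n` restricted to `p`-free `n`; `exitGammaAtom_eq` / `_of_not_mem` / `_nonneg`,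
  **`exitGammaAtom_le_exitGamma`** (`Γ_𝒜 ≤ Γ`), **`exitGammaAtom_eq_exitGamma`** (`Γ_𝒜 = Γ` when `R/p ≤ Q`:
  on such a window `R/x < p`, every admissible death is `p`-free — the case `k = 1` of every `d = 1` cell),
  `sum_exitGammaAtom_sq_div_le_sum` (the atom's energy bracket is at most the all-integer one);
* `exitInflowAtom R Q p y := Σ_{n ≤ R/y, n p-free} (Γ_𝒜(yn)/(yn))·Λ(n)/log(yn)` — the atom's exit measure
  `ν^𝒜` (on `B`) / the Green recursion read backwards (on `W`: `exitInflowAtom_eq_of_mem`);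
  `exitInflowAtom_le_exitInflow`; **`exitInflow_sub_exitInflowAtom`**: for `R/p ≤ Q` the difference is
  EXACTLY the flow through the non-`p`-free prime powers — the TILT `τ(b)/b` of THEOREM B (25.10 (b));
  `exitInflowAtom_eq_exitInflow` (no tilt at window points).

The divergence identity and the Cauchy–Schwarz step on the atom are in `IntegerScrewExitAtom`.
RH-free, elementary.  Nothing in this file bears on the truth of RH.
References: CONTINUUM-LIMIT §25.10–25.11 (rh-explicit A6-PIVOT); M. Suzuki, J. Lond. Math. Soc. (2) 108 (2023)
1448–1487 [Suzuki2023].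
-/

noncomputable section

set_option linter.dupNamespace false -- D-0017: `Summit.<S>.<S>.…` is the designed namespace

namespace Summit.RiemannHypothesis.RiemannHypothesis.Theorems.IntegerScrew

open Finset Real
open ArithmeticFunction (vonMangoldt)

/-! ### Arithmetic of the window -/

/-- If `R / p < y` then `R / y < p` (`p ≥ 1`): on a window of ratio `≤ p` every admissible death is `< p`. -/
theorem div_lt_of_lt {R p y : ℕ} (hp : 1 ≤ p) (hy : R / p < y) : R / y < p := by
  have h1 : R < y * p := (Nat.div_lt_iff_lt_mul (by omega)).1 hy
  have hy1 : 0 < y := by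
    rcases Nat.eq_zero_or_pos y with h | h
    · subst h; simp at h1
    · exact h
  exact (Nat.div_lt_iff_lt_mul hy1).2 (by rw [mul_comm]; exact h1)

/-- `1 ≤ n < p ⇒ n` is `p`-free. -/
theorem smooth_of_lt {n p : ℕ} (hn : 1 ≤ n) (hnp : n < p) : n ∈ Nat.smoothNumbers p :=
  Nat.mem_smoothNumbers_of_lt (by omega) hnp

/-! ### The atom's Green function `Γ_𝒜` -/

/-- **The Green function of the exit-death chain inside the `p`-free atom**: for `Q < x ≤ R`,
`Γ_𝒜(x) = 1 + Σ_{2 ≤ n ≤ R/x, n p-free} (Λ(n)/n)·Γ_𝒜(xn)/log(xn)`, and `Γ_𝒜(x) = 0` off the window.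
[cite: Suzuki2023, §1 (the screw matrices S_M whose pivot/spectral theory this serves)] -/
def exitGammaAtom (R Q p : ℕ) : ℕ → ℝ
  | x =>
    if h : Q < x ∧ x ≤ R then
      1 + ∑ n ∈ ((Icc 2 (R / x)).filter (· ∈ Nat.smoothNumbers p)).attach,
        vonMangoldt n.1 / n.1 * (exitGammaAtom R Q p (x * n.1) / Real.log ((x * n.1 : ℕ) : ℝ))
    else 0
  termination_by x => R + 1 - x
  decreasing_by
    have hn := Finset.mem_Icc.1 (Finset.mem_filter.1 n.2).1
    have hx1 : 0 < x := lt_of_le_of_lt (Nat.zero_le Q) h.1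
    have hle : n.1 * x ≤ R := (Nat.le_div_iff_mul_le hx1).1 hn.2
    have hlt : x < n.1 * x := by nlinarith [hn.1]
    have hcomm : x * n.1 = n.1 * x := mul_comm _ _
    rw [hcomm]
    omega

/-- Off the window `Γ_𝒜 = 0`. -/
theorem exitGammaAtom_of_not_mem {R Q p x : ℕ} (h : ¬(Q < x ∧ x ≤ R)) : exitGammaAtom R Q p x = 0 := by
  rw [exitGammaAtom.eq_def]
  exact dif_neg h

/-- The defining equation on the window, with a plain `Finset` sum. -/
theorem exitGammaAtom_eq {R Q p x : ℕ} (h : Q < x ∧ x ≤ R) :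
    exitGammaAtom R Q p x = 1 + ∑ n ∈ (Icc 2 (R / x)).filter (· ∈ Nat.smoothNumbers p),
      vonMangoldt n / n * (exitGammaAtom R Q p (x * n) / Real.log ((x * n : ℕ) : ℝ)) := by
  conv_lhs => rw [exitGammaAtom.eq_def]
  rw [dif_pos h]
  congr 1
  exact Finset.sum_attach ((Icc 2 (R / x)).filter (· ∈ Nat.smoothNumbers p))
    (fun n => vonMangoldt n / n * (exitGammaAtom R Q p (x * n) / Real.log ((x * n : ℕ) : ℝ)))

/-- `Γ_𝒜 ≥ 0` everywhere. -/
theorem exitGammaAtom_nonneg (R Q p : ℕ) : ∀ x, 0 ≤ exitGammaAtom R Q p x := by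
  suffices H : ∀ k x, R + 1 - x = k → 0 ≤ exitGammaAtom R Q p x from fun x => H _ x rfl
  intro k
  induction k using Nat.strong_induction_on with
  | _ k ih =>
    intro x hk
    by_cases h : Q < x ∧ x ≤ R
    · rw [exitGammaAtom_eq h]
      refine add_nonneg zero_le_one (Finset.sum_nonneg fun n hn => ?_)
      have hn' := Finset.mem_Icc.1 (Finset.mem_filter.1 hn).1
      have hx1 : 1 ≤ x := by omega
      have hxn : x * n ≤ R := by
        have := (Nat.le_div_iff_mul_le (by omega)).1 hn'.2
        rwa [mul_comm] at this
      have hlt : x < x * n := by nlinarith [hn'.1]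
      have hG : 0 ≤ exitGammaAtom R Q p (x * n) := ih (R + 1 - x * n) (by omega) _ rfl
      exact mul_nonneg (div_nonneg ArithmeticFunction.vonMangoldt_nonneg (Nat.cast_nonneg _))
        (div_nonneg hG (Real.log_natCast_nonneg _))
    · rw [exitGammaAtom_of_not_mem h]

/-- **`Γ_𝒜 ≤ Γ`**: restricting the parents to `p`-free ones only removes non-negative terms. -/
theorem exitGammaAtom_le_exitGamma (R Q p : ℕ) : ∀ x, exitGammaAtom R Q p x ≤ exitGamma R Q x := by
  suffices H : ∀ k x, R + 1 - x = k → exitGammaAtom R Q p x ≤ exitGamma R Q x from fun x => H _ x rfl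
  intro k
  induction k using Nat.strong_induction_on with
  | _ k ih =>
    intro x hk
    by_cases h : Q < x ∧ x ≤ R
    · rw [exitGammaAtom_eq h, exitGamma_eq h]
      refine add_le_add le_rfl ?_
      calc ∑ n ∈ (Icc 2 (R / x)).filter (· ∈ Nat.smoothNumbers p),
              vonMangoldt n / n * (exitGammaAtom R Q p (x * n) / Real.log ((x * n : ℕ) : ℝ))
          ≤ ∑ n ∈ (Icc 2 (R / x)).filter (· ∈ Nat.smoothNumbers p),
              vonMangoldt n / n * (exitGamma R Q (x * n) / Real.log ((x * n : ℕ) : ℝ)) := by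
            refine Finset.sum_le_sum fun n hn => ?_
            have hn' := Finset.mem_Icc.1 (Finset.mem_filter.1 hn).1
            have hx1 : 1 ≤ x := by omega
            have hxn : x * n ≤ R := by
              have := (Nat.le_div_iff_mul_le (by omega)).1 hn'.2
              rwa [mul_comm] at this
            have hlt : x < x * n := by nlinarith [hn'.1]
            have hG := ih (R + 1 - x * n) (by omega) (x * n) rfl
            exact mul_le_mul_of_nonneg_left (div_le_div_of_nonneg_right hG (Real.log_natCast_nonneg _))
              (div_nonneg ArithmeticFunction.vonMangoldt_nonneg (Nat.cast_nonneg _))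
        _ ≤ ∑ n ∈ Icc 2 (R / x), vonMangoldt n / n * (exitGamma R Q (x * n) / Real.log ((x * n : ℕ) : ℝ)) :=
            Finset.sum_le_sum_of_subset_of_nonneg (Finset.filter_subset _ _) fun n _ _ =>
              mul_nonneg (div_nonneg ArithmeticFunction.vonMangoldt_nonneg (Nat.cast_nonneg _))
                (div_nonneg (exitGamma_nonneg R Q _) (Real.log_natCast_nonneg _))
    · rw [exitGammaAtom_of_not_mem h, exitGamma_of_not_mem h]

/-- **`Γ_𝒜 = Γ` on windows of ratio at most `p`** (`R/p ≤ Q`): there `R/x < p` for `x ∈ W`, so every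
admissible death is `p`-free and the two recursions coincide (CONTINUUM-LIMIT 25.10 (a), 25.11 (a)). -/
theorem exitGammaAtom_eq_exitGamma {R Q p : ℕ} (hp : 1 ≤ p) (hQ : R / p ≤ Q) :
    ∀ x, exitGammaAtom R Q p x = exitGamma R Q x := by
  suffices H : ∀ k x, R + 1 - x = k → exitGammaAtom R Q p x = exitGamma R Q x from fun x => H _ x rfl
  intro k
  induction k using Nat.strong_induction_on with
  | _ k ih =>
    intro x hk
    by_cases h : Q < x ∧ x ≤ R
    · rw [exitGammaAtom_eq h, exitGamma_eq h]
      have hRx : R / x < p := div_lt_of_lt hp (lt_of_le_of_lt hQ h.1)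
      rw [Finset.filter_true_of_mem (fun n hn => smooth_of_lt (by have := (Finset.mem_Icc.1 hn).1; omega)
        (lt_of_le_of_lt (Finset.mem_Icc.1 hn).2 hRx))]
      congr 1
      refine Finset.sum_congr rfl fun n hn => ?_
      have hn' := Finset.mem_Icc.1 hn
      have hx1 : 1 ≤ x := by omega
      have hxn : x * n ≤ R := by
        have := (Nat.le_div_iff_mul_le (by omega)).1 hn'.2
        rwa [mul_comm] at this
      have hlt : x < x * n := by nlinarith [hn'.1]
      rw [ih (R + 1 - x * n) (by omega) (x * n) rfl]
    · rw [exitGammaAtom_of_not_mem h, exitGamma_of_not_mem h]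

/-- The energy bracket of the atom is at most the all-integer one:
`Σ_{Q<x≤R} Γ_𝒜²/(x log x) ≤ Σ_{Q<x≤R} Γ²/(x log x)`. -/
theorem sum_exitGammaAtom_sq_div_le_sum (R Q p : ℕ) :
    ∑ x ∈ Ioc Q R, exitGammaAtom R Q p x ^ 2 / (x * Real.log x) ≤
      ∑ x ∈ Ioc Q R, exitGamma R Q x ^ 2 / (x * Real.log x) := by
  refine Finset.sum_le_sum fun x _ => div_le_div_of_nonneg_right ?_
    (mul_nonneg (Nat.cast_nonneg _) (Real.log_natCast_nonneg _))
  exact pow_le_pow_left₀ (exitGammaAtom_nonneg R Q p x) (exitGammaAtom_le_exitGamma R Q p x) 2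

/-! ### The atom's exit measure -/

/-- The flow into `y` inside the `p`-free atom: only `p`-free prime powers `n` are admissible.
[cite: Suzuki2023, §1 (the screw matrices S_M whose pivot/spectral theory this serves)] -/
def exitInflowAtom (R Q p y : ℕ) : ℝ :=
  ∑ n ∈ (Icc 1 (R / y)).filter (· ∈ Nat.smoothNumbers p),
    exitGammaAtom R Q p (y * n) / ((y * n : ℕ) : ℝ) * (vonMangoldt n / Real.log ((y * n : ℕ) : ℝ))

/-- `exitInflowAtom ≥ 0`. -/
theorem exitInflowAtom_nonneg (R Q p y : ℕ) : 0 ≤ exitInflowAtom R Q p y :=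
  Finset.sum_nonneg fun _ _ => mul_nonneg (div_nonneg (exitGammaAtom_nonneg R Q p _) (Nat.cast_nonneg _))
    (div_nonneg ArithmeticFunction.vonMangoldt_nonneg (Real.log_natCast_nonneg _))

/-- On the window the atom's inflow is its Green recursion read backwards: `inflow^𝒜(y) = Γ_𝒜(y)/y − 1/y`. -/
theorem exitInflowAtom_eq_of_mem {R Q p y : ℕ} (h : Q < y ∧ y ≤ R) :
    exitInflowAtom R Q p y = exitGammaAtom R Q p y / y - 1 / y := by
  have hy0 : (y : ℝ) ≠ 0 := by exact_mod_cast (show y ≠ 0 by omega)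
  have hRy : 1 ≤ R / y := Nat.div_pos h.2 (by omega)
  unfold exitInflowAtom
  have hI : (Icc 1 (R / y)).filter (· ∈ Nat.smoothNumbers p) =
      insert 1 ((Icc 2 (R / y)).filter (· ∈ Nat.smoothNumbers p)) := by
    ext n
    simp only [Finset.mem_insert, Finset.mem_filter, Finset.mem_Icc]
    constructor
    · rintro ⟨⟨h1, h2⟩, hs⟩
      by_cases hn : n = 1
      · exact Or.inl hn
      · exact Or.inr ⟨⟨by omega, h2⟩, hs⟩
    · rintro (rfl | ⟨⟨h1, h2⟩, hs⟩)
      · exact ⟨⟨le_rfl, hRy⟩, Literature.NumberTheory.LFunctions.Halasz.one_mem_smoothNumbers p⟩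
      · exact ⟨⟨by omega, h2⟩, hs⟩
  have h1 : (1 : ℕ) ∉ (Icc 2 (R / y)).filter (· ∈ Nat.smoothNumbers p) := by simp
  rw [hI, Finset.sum_insert h1, ArithmeticFunction.vonMangoldt_apply_one, zero_div, mul_zero, zero_add,
    exitGammaAtom_eq h, add_div, Finset.sum_div]
  have hterm : ∀ n ∈ (Icc 2 (R / y)).filter (· ∈ Nat.smoothNumbers p),
      exitGammaAtom R Q p (y * n) / ((y * n : ℕ) : ℝ) * (vonMangoldt n / Real.log ((y * n : ℕ) : ℝ)) =
        vonMangoldt n / n * (exitGammaAtom R Q p (y * n) / Real.log ((y * n : ℕ) : ℝ)) / y := by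
    intro n hn
    have hn0 : (n : ℝ) ≠ 0 := by
      exact_mod_cast (show n ≠ 0 by have := (Finset.mem_Icc.1 (Finset.mem_filter.1 hn).1).1; omega)
    push_cast
    field_simp
  rw [Finset.sum_congr rfl hterm]
  ring

/-- `exitInflowAtom ≤ exitInflow`: fewer admissible `n` and `Γ_𝒜 ≤ Γ`. -/
theorem exitInflowAtom_le_exitInflow (R Q p y : ℕ) : exitInflowAtom R Q p y ≤ exitInflow R Q y := by
  unfold exitInflowAtom exitInflow
  calc ∑ n ∈ (Icc 1 (R / y)).filter (· ∈ Nat.smoothNumbers p),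
          exitGammaAtom R Q p (y * n) / ((y * n : ℕ) : ℝ) * (vonMangoldt n / Real.log ((y * n : ℕ) : ℝ))
      ≤ ∑ n ∈ (Icc 1 (R / y)).filter (· ∈ Nat.smoothNumbers p),
          exitGamma R Q (y * n) / ((y * n : ℕ) : ℝ) * (vonMangoldt n / Real.log ((y * n : ℕ) : ℝ)) :=
        Finset.sum_le_sum fun n _ => mul_le_mul_of_nonneg_right
          (div_le_div_of_nonneg_right (exitGammaAtom_le_exitGamma R Q p _) (Nat.cast_nonneg _))
          (div_nonneg ArithmeticFunction.vonMangoldt_nonneg (Real.log_natCast_nonneg _))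
    _ ≤ _ := Finset.sum_le_sum_of_subset_of_nonneg (Finset.filter_subset _ _) fun n _ _ =>
        mul_nonneg (div_nonneg (exitGamma_nonneg R Q _) (Nat.cast_nonneg _))
          (div_nonneg ArithmeticFunction.vonMangoldt_nonneg (Real.log_natCast_nonneg _))

/-- **The tilt** (THEOREM B, CONTINUUM-LIMIT 25.10 (b)): on a window of ratio at most `p` (`R/p ≤ Q`) the
all-integer exit measure exceeds the atom's one EXACTLY by the flow through the non-`p`-free prime powers,
`exitInflow(y) − exitInflowAtom(y) = Σ_{n ≤ R/y, n not p-free} (Γ(yn)/(yn))·Λ(n)/log(yn)` (`= τ(y)/y`). -/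
theorem exitInflow_sub_exitInflowAtom {R Q p : ℕ} (hp : 1 ≤ p) (hQ : R / p ≤ Q) (y : ℕ) :
    exitInflow R Q y - exitInflowAtom R Q p y =
      ∑ n ∈ (Icc 1 (R / y)).filter (· ∉ Nat.smoothNumbers p),
        exitGamma R Q (y * n) / ((y * n : ℕ) : ℝ) * (vonMangoldt n / Real.log ((y * n : ℕ) : ℝ)) := by
  unfold exitInflow exitInflowAtom
  simp_rw [exitGammaAtom_eq_exitGamma hp hQ]
  rw [← Finset.sum_filter_add_sum_filter_not (Icc 1 (R / y)) (· ∈ Nat.smoothNumbers p)]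
  ring

/-- On a window of ratio at most `p`, at window points the two inflows agree (no `n ≤ R/y` reaches `p`). -/
theorem exitInflowAtom_eq_exitInflow {R Q p y : ℕ} (hp : 1 ≤ p) (hQ : R / p ≤ Q) (hy : Q < y) :
    exitInflowAtom R Q p y = exitInflow R Q y := by
  have h := exitInflow_sub_exitInflowAtom hp hQ y
  have hz : ∑ n ∈ (Icc 1 (R / y)).filter (· ∉ Nat.smoothNumbers p),
      exitGamma R Q (y * n) / ((y * n : ℕ) : ℝ) * (vonMangoldt n / Real.log ((y * n : ℕ) : ℝ)) = 0 := by
    refine Finset.sum_eq_zero fun n hn => ?_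
    have hn' := Finset.mem_filter.1 hn
    have hI := Finset.mem_Icc.1 hn'.1
    exact absurd (smooth_of_lt hI.1 (lt_of_le_of_lt hI.2 (div_lt_of_lt hp (lt_of_le_of_lt hQ hy)))) hn'.2
  linarith

end Summit.RiemannHypothesis.RiemannHypothesis.Theorems.IntegerScrew

end
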